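import Mathlib.Analysis.LocallyConvex.Separation
import Mathlib.Analysis.Convex.StdSimplex
import Mathlib.Topology.Semicontinuity.Basic
import Mathlib.Topology.Algebra.Module.FiniteDimension
import Mathlib.Analysis.InnerProductSpace.PiL2
import Mathlib.Algebra.BigOperators.Field
import HarnessLib

/-!
# Stub `stub_fanMinimax` of the line `dissipation-deficit-duality`
# (crux stmt-AnomalousDissipation-14091, `TaylorCertificates.FloorCertificate`)

**Ky Fan's convex-like minimax principle** (K. Fan, *Minimax theorems*, Proc. Nat. Acad. Sci. USA
39 (1953) 42–47, Theorem 2), in `γ`-form and with no vector-space structure on the two variables: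
`X` compact, `Y` nonempty, `φ : X → Y → ℝ` with `φ(·, y)` lower semicontinuous for every `y`,
`φ` CONVEX-LIKE in `x` (for `x₁, x₂` and `t ∈ [0,1]` some `x₀` has
`φ(x₀, y) ≤ t φ(x₁, y) + (1 - t) φ(x₂, y)` for all `y`) and CONCAVE-LIKE in `y` (dually). Then:
if every `x` is beaten by some `y` strictly above the level `γ`, ONE `y` beats every `x` strictly
above `γ` (`fan_minimax`, registered form `stub_fanMinimax`).

Fan's proof, as formalised here:

* `concaveLike_sum` — two-point concave-likeness iterates to finite convex combinations
  (induction on the finset of indices);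
* `exists_forall_lt_of_finite` — the finite-dimensional heart: if finitely many `yᵢ` achieve
  `maxᵢ φ(x, yᵢ) ≥ β > γ` for every `x`, the convex set `E = {z ∈ ℝ^ι | ∃ x, ∀ i, φ(x, yᵢ) ≤ zᵢ}`
  misses the open box `{z | ∀ i, zᵢ < β}`; a separating functional (`geometric_hahn_banach_open`,
  pattern of `Literature/Analysis/Convex/MinMax.lean`) has nonnegative weights, not all zero, and
  after normalisation `∑ λᵢ φ(x, yᵢ) > γ` for all `x`, which concave-likeness turns into one `y₀`;
* `fan_minimax` — compactness: the open sets `{x | b < φ(x, y)}` (`γ < b`, open by lower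
  semicontinuity) cover `X`, a finite subcover gives the `yᵢ` and the margin `β = min b > γ`
  (`X = ∅` is the trivial case, settled by `Nonempty Y`).

No topology or linear structure on `Y` and no linear structure on `X` is used; this is the
abstract ingredient of the strong-duality step of the line (applied there with `X` a compact convex
set of probability measures and `Y` a convex class of multipliers).
-/

-- `Summit.<Summit>.<Problem>` is the tree's mandated summit-side namespace (CONVENTIONS §2); for this
-- single-conjunct summit the two coincide, so the duplicate is deliberate.
set_option linter.dupNamespace false

open Set

namespace Summit.AnomalousDissipation.AnomalousDissipation.Theorems.TaylorCertificatesFloorCertificate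

/-- **Concave-likeness iterates to finite convex combinations.** If `φ` is concave-like in `y`
(two-point form), then for points `ys i` and nonnegative weights `lam i` on a finset `s` summing
to `1` there is one `y₀` dominating the mixture: `∑ i ∈ s, lam i * φ x (ys i) ≤ φ x y₀` for every
`x`. Induction on `s`: split off one index, rescale the remaining weights, combine the inductive
witness with the split-off point by two-point concave-likeness. [Fan 1953, proof of Thm 2] -/
theorem concaveLike_sum {X Y ι : Type*} (φ : X → Y → ℝ)
    (hconc : ∀ (y₁ y₂ : Y) (t : ℝ), 0 ≤ t → t ≤ 1 →
      ∃ y₀ : Y, ∀ x : X, t * φ x y₁ + (1 - t) * φ x y₂ ≤ φ x y₀)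
    (ys : ι → Y) (s : Finset ι) :
    ∀ lam : ι → ℝ, (∀ i ∈ s, 0 ≤ lam i) → ∑ i ∈ s, lam i = 1 →
      ∃ y₀ : Y, ∀ x : X, ∑ i ∈ s, lam i * φ x (ys i) ≤ φ x y₀ := by
  classical
  induction s using Finset.induction_on with
  | empty =>
    intro lam _ hsum
    simp at hsum
  | insert a s ha ih =>
    intro lam hlam hsum
    rw [Finset.sum_insert ha] at hsum
    have hlam' : ∀ i ∈ s, 0 ≤ lam i := fun i hi => hlam i (Finset.mem_insert_of_mem hi)
    have ha0 : 0 ≤ lam a := hlam a (Finset.mem_insert_self a s)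
    have hS0 : 0 ≤ ∑ i ∈ s, lam i := Finset.sum_nonneg hlam'
    rcases hS0.eq_or_lt with hS | hS
    · -- all the weights on `s` vanish, so `lam a = 1` and `y₀ = ys a` works
      have hz : ∀ i ∈ s, lam i = 0 := fun i hi =>
        (Finset.sum_eq_zero_iff_of_nonneg hlam').1 hS.symm i hi
      refine ⟨ys a, fun x => ?_⟩
      rw [Finset.sum_insert ha, Finset.sum_eq_zero fun i hi => by rw [hz i hi, zero_mul],
        add_zero]
      have h1 : lam a = 1 := by linarith
      rw [h1, one_mul]
    · -- rescale the weights on `s`, use the induction hypothesis, then two-point concave-likeness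
      have hsum' : ∑ i ∈ s, lam i / (∑ j ∈ s, lam j) = 1 := by
        rw [← Finset.sum_div, div_self hS.ne']
      obtain ⟨y', hy'⟩ := ih (fun i => lam i / ∑ j ∈ s, lam j)
        (fun i hi => div_nonneg (hlam' i hi) hS.le) hsum'
      obtain ⟨y₀, hy₀⟩ := hconc (ys a) y' (lam a) ha0 (by linarith)
      refine ⟨y₀, fun x => ?_⟩
      rw [Finset.sum_insert ha]
      have h1 : ∑ i ∈ s, lam i / (∑ j ∈ s, lam j) * φ x (ys i) ≤ φ x y' := hy' x
      have h2 := hy₀ x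
      have h3 : ∑ i ∈ s, lam i * φ x (ys i) =
          (∑ j ∈ s, lam j) * ∑ i ∈ s, lam i / (∑ j ∈ s, lam j) * φ x (ys i) := by
        rw [Finset.mul_sum]
        refine Finset.sum_congr rfl fun i _ => ?_
        rw [← mul_assoc, mul_div_cancel₀ _ hS.ne']
      have h4 : (1 : ℝ) - lam a = ∑ j ∈ s, lam j := by linarith
      rw [h4] at h2
      rw [h3]
      have h5 := mul_le_mul_of_nonneg_left h1 hS.le
      linarith

/-- **Fan's theorem for finitely many `y`'s (the separation step).** If `φ` is convex-like in
`x` and concave-like in `y`, `γ < β`, and finitely many points `ys i` satisfy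
`∀ x, ∃ i, β ≤ φ x (ys i)`, then a single `y` has `γ < φ x y` for every `x`. The convex set
`E = {z : ι → ℝ | ∃ x, ∀ i, φ x (ys i) ≤ z i}` misses the open convex box `{z | ∀ i, z i < β}`;
separate them by `geometric_hahn_banach_open`; the functional `z ↦ ∑ z i * w i` has `w i ≥ 0`
(the box is unbounded below), `∑ w i > 0` (else the functional vanishes on both sides), and the
normalised weights give `γ < ∑ (w i / ∑ w) * φ x (ys i)` for all `x` (test the box point `γ·1` and
the point `(φ x (ys i))ᵢ ∈ E`); `concaveLike_sum` produces the single `y`.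
[Fan 1953, Thm 2, proof] -/
theorem exists_forall_lt_of_finite {X Y ι : Type*} [Fintype ι] [Nonempty Y] (φ : X → Y → ℝ)
    (hconv : ∀ (x₁ x₂ : X) (t : ℝ), 0 ≤ t → t ≤ 1 →
      ∃ x₀ : X, ∀ y : Y, φ x₀ y ≤ t * φ x₁ y + (1 - t) * φ x₂ y)
    (hconc : ∀ (y₁ y₂ : Y) (t : ℝ), 0 ≤ t → t ≤ 1 →
      ∃ y₀ : Y, ∀ x : X, t * φ x y₁ + (1 - t) * φ x y₂ ≤ φ x y₀)
    (ys : ι → Y) {β γ : ℝ} (hγβ : γ < β) (h : ∀ x : X, ∃ i, β ≤ φ x (ys i)) :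
    ∃ y : Y, ∀ x : X, γ < φ x y := by
  classical
  rcases isEmpty_or_nonempty X with hX | hX
  · obtain ⟨y⟩ := ‹Nonempty Y›
    exact ⟨y, fun x => (hX.false x).elim⟩
  -- the epigraph-like set `E` and the open box `B`
  obtain ⟨E, hE⟩ : ∃ E : Set (ι → ℝ), ∀ z, z ∈ E ↔ ∃ x : X, ∀ i, φ x (ys i) ≤ z i :=
    ⟨{z | ∃ x : X, ∀ i, φ x (ys i) ≤ z i}, fun _ => Iff.rfl⟩
  obtain ⟨B, hBdef⟩ : ∃ B : Set (ι → ℝ), B = Set.pi Set.univ fun _ => Set.Iio β := ⟨_, rfl⟩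
  have hB : ∀ z : ι → ℝ, z ∈ B ↔ ∀ i, z i < β := fun z => by
    rw [hBdef, Set.mem_univ_pi]
    simp only [Set.mem_Iio]
  have hEc : Convex ℝ E := by
    intro z₁ hz₁ z₂ hz₂ a b ha hb hab
    obtain ⟨x₁, hx₁⟩ := (hE z₁).1 hz₁
    obtain ⟨x₂, hx₂⟩ := (hE z₂).1 hz₂
    obtain ⟨x₀, hx₀⟩ := hconv x₁ x₂ a ha (by linarith)
    refine (hE _).2 ⟨x₀, fun i => ?_⟩
    have h1 := mul_le_mul_of_nonneg_left (hx₁ i) ha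
    have h2 := mul_le_mul_of_nonneg_left (hx₂ i) hb
    have h3 := hx₀ (ys i)
    rw [show (1 : ℝ) - a = b by linarith] at h3
    simp only [Pi.add_apply, Pi.smul_apply, smul_eq_mul]
    linarith
  have hBc : Convex ℝ B := hBdef ▸ convex_pi fun _ _ => convex_Iio β
  have hBo : IsOpen B := hBdef ▸ isOpen_set_pi Set.finite_univ fun _ _ => isOpen_Iio
  have hdisj : Disjoint B E := by
    refine Set.disjoint_left.2 fun z hzB hzE => ?_
    obtain ⟨x, hx⟩ := (hE z).1 hzE
    obtain ⟨i, hi⟩ := h x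
    exact absurd (hi.trans (hx i)) (not_le.2 ((hB z).1 hzB i))
  obtain ⟨f, u, hfB, hfE⟩ := geometric_hahn_banach_open hBc hBo hEc hdisj
  -- the functional as a weight vector `w`
  obtain ⟨w, hw⟩ : ∃ w : ι → ℝ, ∀ i, w i = f (Pi.single i 1) := ⟨_, fun _ => rfl⟩
  have hf : ∀ z, f z = ∑ i, z i * w i := by
    -- adapted from `Literature.Analysis.Convex.MinMax.dual_apply_eq_sum`
    intro z
    conv_lhs => rw [show z = ∑ i, z i • (Pi.single i (1 : ℝ) : ι → ℝ) by
      funext k; simp [Finset.sum_apply, Pi.single_apply]]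
    rw [map_sum]
    simp [smul_eq_mul, hw]
  have hγB : (fun _ : ι => γ) ∈ B := (hB _).2 fun _ => hγβ
  have hγu : f (fun _ : ι => γ) < u := hfB _ hγB
  -- the weights are nonnegative: the box is unbounded below in the direction `-e_i`
  have hw0 : ∀ i, 0 ≤ w i := by
    intro i
    by_contra hneg
    have hwi : 0 < -w i := by linarith [not_le.1 hneg]
    obtain ⟨L, hL0, hid⟩ :
        ∃ L : ℝ, 0 ≤ L ∧ L * (-w i) = (u - f (fun _ : ι => γ)) + (-w i) := by
      refine ⟨(u - f (fun _ : ι => γ)) / (-w i) + 1, ?_, ?_⟩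
      · have h1 : 0 ≤ (u - f (fun _ : ι => γ)) / (-w i) := div_nonneg (by linarith) hwi.le
        linarith
      · rw [add_mul, one_mul, div_mul_cancel₀ _ hwi.ne']
    have hmem : ((fun _ : ι => γ) - L • (Pi.single i (1 : ℝ) : ι → ℝ)) ∈ B := by
      refine (hB _).2 fun k => ?_
      simp only [Pi.sub_apply, Pi.smul_apply, Pi.single_apply, smul_eq_mul]
      split_ifs <;> nlinarith
    have hlt := hfB _ hmem
    rw [map_sub, map_smul, smul_eq_mul, ← hw i] at hlt
    nlinarith
  -- the weights are not all zero: otherwise `f = 0` lies strictly below and weakly above `u`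
  have hW : 0 < ∑ i, w i := by
    rcases (Finset.sum_nonneg fun i _ => hw0 i).eq_or_lt with h0 | h0
    · exfalso
      have hwz : ∀ i, w i = 0 := fun i =>
        (Finset.sum_eq_zero_iff_of_nonneg fun i _ => hw0 i).1 h0.symm i (Finset.mem_univ i)
      have hf0 : ∀ z, f z = 0 := fun z => by rw [hf]; simp [hwz]
      obtain ⟨x⟩ := hX
      have h1 := hfE (fun i => φ x (ys i)) ((hE _).2 ⟨x, fun i => le_rfl⟩)
      rw [hf0] at h1 hγu
      linarith
    · exact h0
  -- normalise and apply iterated concave-likeness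
  have hsum1 : ∑ i, w i / (∑ j, w j) = 1 := by rw [← Finset.sum_div, div_self hW.ne']
  obtain ⟨y₀, hy₀⟩ := concaveLike_sum φ hconc ys Finset.univ (fun i => w i / ∑ j, w j)
    (fun i _ => div_nonneg (hw0 i) hW.le) hsum1
  refine ⟨y₀, fun x => lt_of_lt_of_le ?_ (hy₀ x)⟩
  have h2 := hfE (fun i => φ x (ys i)) ((hE _).2 ⟨x, fun i => le_rfl⟩)
  rw [hf] at h2 hγu
  rw [← Finset.mul_sum] at hγu
  have h4 : ∑ i, w i / (∑ j, w j) * φ x (ys i) = (∑ i, φ x (ys i) * w i) / ∑ j, w j := by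
    rw [Finset.sum_div]
    exact Finset.sum_congr rfl fun i _ => by ring
  show γ < ∑ i, w i / (∑ j, w j) * φ x (ys i)
  rw [h4, lt_div_iff₀ hW]
  exact lt_of_lt_of_le hγu h2

/-- **Ky Fan's convex-like minimax principle** (`γ`-form). `X` compact, `Y` nonempty,
`φ(·, y)` lower semicontinuous for each `y`, `φ` convex-like in `x` and concave-like in `y`:
if every `x` admits some `y` with `γ < φ x y`, then one `y` has `γ < φ x y` for every `x`.
Proof: the open sets `{x | b < φ x y}` with `γ < b` cover `X`; a finite subcover (compactness)
yields finitely many `yᵢ` and a margin `β = min bᵢ > γ` with `∀ x, ∃ i, β ≤ φ x (ys i)`, and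
`exists_forall_lt_of_finite` concludes. [Fan 1953, Thm 2] -/
theorem fan_minimax {X Y : Type*} [TopologicalSpace X] [CompactSpace X] [Nonempty Y]
    (φ : X → Y → ℝ) (hlsc : ∀ y : Y, LowerSemicontinuous fun x : X => φ x y)
    (hconv : ∀ (x₁ x₂ : X) (t : ℝ), 0 ≤ t → t ≤ 1 →
      ∃ x₀ : X, ∀ y : Y, φ x₀ y ≤ t * φ x₁ y + (1 - t) * φ x₂ y)
    (hconc : ∀ (y₁ y₂ : Y) (t : ℝ), 0 ≤ t → t ≤ 1 →
      ∃ y₀ : Y, ∀ x : X, t * φ x y₁ + (1 - t) * φ x y₂ ≤ φ x y₀)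
    (γ : ℝ) (H : ∀ x : X, ∃ y : Y, γ < φ x y) : ∃ y : Y, ∀ x : X, γ < φ x y := by
  classical
  -- open cover of `X` by the sets `{x | b < φ x y}`, indexed by pairs `(y, b)` with `γ < b`
  obtain ⟨U, hU⟩ : ∃ U : {p : Y × ℝ // γ < p.2} → Set X,
      ∀ p, U p = (fun x => φ x p.1.1) ⁻¹' Set.Ioi p.1.2 := ⟨_, fun _ => rfl⟩
  have hUo : ∀ p, IsOpen (U p) := fun p => (hU p) ▸ (hlsc p.1.1).isOpen_preimage p.1.2
  have hmemU : ∀ p x, x ∈ U p ↔ p.1.2 < φ x p.1.1 := fun p x => by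
    rw [hU p, Set.mem_preimage, Set.mem_Ioi]
  have hcov : (Set.univ : Set X) ⊆ ⋃ p, U p := by
    intro x _
    obtain ⟨y, hy⟩ := H x
    have hmid : γ < (γ + φ x y) / 2 := by linarith
    refine Set.mem_iUnion.2 ⟨⟨(y, (γ + φ x y) / 2), hmid⟩, (hmemU _ _).2 ?_⟩
    show (γ + φ x y) / 2 < φ x y
    linarith
  obtain ⟨t, ht⟩ := isCompact_univ.elim_finite_subcover U hUo hcov
  rcases t.eq_empty_or_nonempty with rfl | hne
  · -- then `X` is empty
    obtain ⟨y⟩ := ‹Nonempty Y›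
    refine ⟨y, fun x => ?_⟩
    have hx := ht (Set.mem_univ x)
    simp at hx
  -- the margin `β = min b > γ`
  have hβ : γ < t.inf' hne fun p => p.1.2 := (Finset.lt_inf'_iff hne).2 fun p _ => p.2
  refine exists_forall_lt_of_finite φ hconv hconc (fun i : t => i.1.1.1) hβ fun x => ?_
  obtain ⟨p, hp, hx⟩ := Set.mem_iUnion₂.1 (ht (Set.mem_univ x))
  have hx' : p.1.2 < φ x p.1.1 := (hmemU p x).1 hx
  exact ⟨⟨p, hp⟩, (Finset.inf'_le (fun q : {p : Y × ℝ // γ < p.2} => q.1.2) hp).trans hx'.le⟩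

/-- **S2 `stub_fanMinimax`** — the registered form of Ky Fan's convex-like minimax principle
(`fan_minimax` at universe level `0`): `X` compact, `Y` nonempty, `φ(·, y)` lower semicontinuous,
`φ` convex-like in `x` and concave-like in `y`; if every `x` is beaten by some `y` strictly above
`γ`, one `y` beats every `x` strictly above `γ`. [Fan 1953, Thm 2] -/
theorem stub_fanMinimax :
    ∀ (X Y : Type) [TopologicalSpace X] [CompactSpace X] [Nonempty Y] (φ : X → Y → ℝ),
      (∀ y : Y, LowerSemicontinuous fun x : X => φ x y) →
      (∀ (x₁ x₂ : X) (t : ℝ), 0 ≤ t → t ≤ 1 → ∃ x₀ : X, ∀ y : Y, φ x₀ y ≤ t * φ x₁ y + (1 - t) * φ x₂ y) →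
      (∀ (y₁ y₂ : Y) (t : ℝ), 0 ≤ t → t ≤ 1 → ∃ y₀ : Y, ∀ x : X, t * φ x y₁ + (1 - t) * φ x y₂ ≤ φ x y₀) →
      ∀ γ : ℝ, (∀ x : X, ∃ y : Y, γ < φ x y) → ∃ y : Y, ∀ x : X, γ < φ x y :=
  fun _ _ _ _ _ φ hlsc hconv hconc γ H => fan_minimax φ hlsc hconv hconc γ H

end Summit.AnomalousDissipation.AnomalousDissipation.Theorems.TaylorCertificatesFloorCertificate
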